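import Summits.QuantumFields.BalabanUV.T4Continuum.Support.NE7HintOfLandauMinSupSU2
import HarnessLib

/-!
# NE7CubeChartOfLandauELGeneric — PORT MAP P2.3b: THE CUBE GRADIENT LETTER FROM A LOCAL LANDAU CHART (EL FORM) AT ANY BLOCK SIZE `L ≥ 2`, ANY `U(n)` —
# `NE7HintOfLandauMinSupSU2.cubeChart_of_landauEL` (`L = 2`, `nbRad 4 2 = 20`, letter width `2ℓ + 32`) RE-ISSUED with `nbRad 4 L = 10L`, width `L′ = 10L + 2ℓ + 12 (≥ 32)`:
# at a configuration with `SmallField U (r∕M²)` (`M = L^{k+1}`), current `‖covDiv 1 U‖ ≤ C·r∕M³`, a unitary site gauge `u₀` with `U^{u₀} = e^{A}` (skew, `‖A‖ ≤ c₀t∕M`) and the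
# lattice Landau condition on the sup-cube of radius `(nbRad 4 L + 2ℓ + 12)·M + 2` about `z`, and `t = r + 4(e^β − 1) + ε ≤ 1∕(1152·L′·(c₀+1))`: on the cube of radius
# `(nbRad 4 L + 2ℓ + 11)·M` the gradient letter `‖A(p + e_τ, μ) − A(p, μ)‖ ≤ (62c₀ + L′²(2C + 32c₀ + 48))·t∕M²`

Cell `pub-balaban`, rung (B)+1 sub-cell t4, lineage `b2b-balaban-t4-ne7-p1`, generation 109 (CRUX PROVER NE7 #1 = OWNER of BINDER row NE7).  Memo
`t4/b2b-balaban-t4-ne7-p1-g109/ROAD-G109.md` §3 (PORT MAP item P2.3b; consumer: the generic re-issue of F306 `hint_of_landauELChart`).  Proof = F305's §2 verbatim under the recipe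
(`2^{k+1} ↦ L^{k+1}`, `20 ↦ 10L`), over F303 `NE7CubeGradientLandauEL.norm_fdiff_le_of_landauEL_cube` (any `d`), F305 §1 `sinhDiv_eq_zero_of_EL` (any `d`) and the pure-real
`NE7HintOfLandauSupChartSU2.gradLetter_arith` (needs only `L′ ≥ 32`).
WHAT ([folklore]; 0 def, 0 sorry).  **`cubeChart_of_landauEL_generic`**.
HONEST FRAMING (page 1): elementary lattice analysis of OUR objects; the Landau chart is a HYPOTHESIS; nothing of Bałaban's asserted; NE7 NOT proved; spine 0∕9; finite T⁴ rung (B)+1 — NOT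
infinite volume, NOT mass gap, NOT BetaPertH, NOT Clay (continuum YM on T⁴ ⇐ BetaPertH ∧ nine spine estimates).
-/

set_option autoImplicit false

open scoped BigOperators Matrix Matrix.Norms.L2Operator Topology
open NormedSpace Finset Set Filter

namespace Summit.QuantumFields.BalabanUV.T4Continuum.NE7CubeChartOfLandauELGeneric

open Literature.MathematicalPhysics.QuantumFieldTheory.Balaban1983to89
open B7Prop1Explicit B7Prop2Explicit MatrixLog UnitaryModel MatrixNorms
open B4TorusKernel.MultiPeriod (torusSupNorm)
open B8Ineq132 (covDiv)
open T4AveragingDeficitWall (Ad IsUnitaryCfg IsSkewDir SmallField vary curl curlSq dirSq dirL1)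
open T4AveragingDeficitWallBoundary (IsPeriodicCfg periodBox)
open BlockAverageVaryHolo (nbRad)
open NE3EnergyShapes (IsUnitarySite)
open NE7HintOfLandauSupChartSU2 (gradLetter_arith)
open NE7CubeGradientLandauEL (norm_fdiff_le_of_landauEL_cube)
open NE7HintOfLandauMinSupSU2 (sinhDiv_eq_zero_of_EL)
open Literature.NumberTheory.Sieve.SquarefreeSums (exp_sub_one_le_two_mul)

noncomputable section

variable {n : Type*} [Fintype n] [DecidableEq n]

set_option maxHeartbeats 800000 in
/-- **THE CUBE GRADIENT LETTER FROM A LOCAL LANDAU CHART (EL FORM), ANY `L ≥ 2`** (statement in the file header; F305 §2 generic). [folklore] -/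
theorem cubeChart_of_landauEL_generic [Nonempty n] {L : ℕ} (hL : 2 ≤ L) (ℓ k : ℕ) {U : Site 4 → Fin 4 → (Matrix n n ℂ)ˣ} {r ε β c₀ C : ℝ}
    (hr0 : 0 ≤ r) (hε0 : 0 ≤ ε) (hβ0 : 0 ≤ β) (hc₀ : 0 ≤ c₀) (hC : 0 ≤ C)
    (ht : r + 4 * (Real.exp β - 1) + ε ≤ 1 / (1152 * (10 * (L : ℝ) + 2 * (ℓ : ℝ) + 12) * (c₀ + 1)))
    (hUr : SmallField U (r / ((L : ℝ) ^ (k + 1)) ^ 2))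
    (hcur : ∀ (ν : Fin 4) (y : Site 4), ‖covDiv 1 U ν y‖ ≤ C * r / ((L : ℝ) ^ (k + 1)) ^ 3)
    {u₀ : Site 4 → (Matrix n n ℂ)ˣ} (hu₀ : IsUnitarySite u₀) {A : Site 4 → Fin 4 → Matrix n n ℂ} (z : Site 4)
    (hUA : ∀ (p : Site 4) (μ : Fin 4), (∀ i, |p i - z i| ≤ (((nbRad 4 L + 2 * ℓ + 12) * L ^ (k + 1) + 2 : ℕ) : ℤ)) → gaugeAct u₀ U p μ = expUnit (A p μ))
    (hskew : ∀ (p : Site 4) (μ : Fin 4), (∀ i, |p i - z i| ≤ (((nbRad 4 L + 2 * ℓ + 12) * L ^ (k + 1) + 2 : ℕ) : ℤ)) → A p μ ∈ skewAdjoint (Matrix n n ℂ))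
    (hA0 : ∀ (p : Site 4) (μ : Fin 4), (∀ i, |p i - z i| ≤ (((nbRad 4 L + 2 * ℓ + 12) * L ^ (k + 1) + 2 : ℕ) : ℤ)) →
      ‖A p μ‖ ≤ c₀ * (r + 4 * (Real.exp β - 1) + ε) / (L : ℝ) ^ (k + 1))
    (hEL : ∀ (y : Site 4), (∀ i, |y i - z i| ≤ (((nbRad 4 L + 2 * ℓ + 12) * L ^ (k + 1) + 2 : ℕ) : ℤ)) →
      ∑ κ : Fin 4, ((((gaugeAct u₀ U y κ : (Matrix n n ℂ)ˣ) : Matrix n n ℂ) - ((gaugeAct u₀ U y κ : (Matrix n n ℂ)ˣ) : Matrix n n ℂ)ᴴ)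
        - (((gaugeAct u₀ U (y - e κ) κ : (Matrix n n ℂ)ˣ) : Matrix n n ℂ) - ((gaugeAct u₀ U (y - e κ) κ : (Matrix n n ℂ)ˣ) : Matrix n n ℂ)ᴴ)) = 0)
    (p : Site 4) (μ τ : Fin 4) (hp : ∀ i, |p i - z i| ≤ (((nbRad 4 L + 2 * ℓ + 11) * L ^ (k + 1) : ℕ) : ℤ)) :
    ‖A (p + e τ) μ - A p μ‖
      ≤ (62 * c₀ + (10 * (L : ℝ) + 2 * (ℓ : ℝ) + 12) ^ 2 * (2 * C + 32 * c₀ + 48 + 2 * 0)) * (r + 4 * (Real.exp β - 1) + ε) / ((L : ℝ) ^ (k + 1)) ^ 2 := by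
  set Lp : ℝ := 10 * (L : ℝ) + 2 * (ℓ : ℝ) + 12 with hLp
  -- the EL reaction vanishes in the log chart on the cube of radius `R₀ − 2`
  have e1 : ∀ (a : Fin 4) (i : Fin 4), |(e a : Site 4) i| ≤ 1 := fun a i => by rw [e_apply]; split_ifs <;> simp
  have near1 : ∀ (x : Site 4) (a : Fin 4) (c : ℤ), (∀ i, |x i - z i| ≤ c) → ∀ i, |(x + e a) i - z i| ≤ c + 1 := fun x a c hx i => by
    have : |(x + e a) i - z i| ≤ |(e a : Site 4) i| + |x i - z i| := by
      rw [show (x + e a) i - z i = (e a : Site 4) i + (x i - z i) by simp; ring]; exact abs_add_le _ _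
    linarith [e1 a i, hx i]
  have near1m : ∀ (x : Site 4) (a : Fin 4) (c : ℤ), (∀ i, |x i - z i| ≤ c) → ∀ i, |(x - e a) i - z i| ≤ c + 1 := fun x a c hx i => by
    have : |(x - e a) i - z i| ≤ |(e a : Site 4) i| + |x i - z i| := by
      rw [show (x - e a) i - z i = -(e a : Site 4) i + (x i - z i) by simp; ring]
      exact (abs_add_le _ _).trans (by rw [abs_neg])
    linarith [e1 a i, hx i]
  have hdivS : ∀ (y : Site 4), (∀ i, |y i - z i| ≤ (((nbRad 4 L + 2 * ℓ + 12) * L ^ (k + 1) + 2 : ℕ) : ℤ) - 1) →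
      ∑ κ : Fin 4, (((2 : ℂ)⁻¹ • (exp (A y κ) - exp (-A y κ))) - ((2 : ℂ)⁻¹ • (exp (A (y - e κ) κ) - exp (-A (y - e κ) κ)))) = 0 := by
    intro y hy
    have hy0 : ∀ i, |y i - z i| ≤ (((nbRad 4 L + 2 * ℓ + 12) * L ^ (k + 1) + 2 : ℕ) : ℤ) := fun i => (hy i).trans (by linarith)
    have hym : ∀ κ : Fin 4, ∀ i, |(y - e κ) i - z i| ≤ (((nbRad 4 L + 2 * ℓ + 12) * L ^ (k + 1) + 2 : ℕ) : ℤ) := fun κ i => by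
      linarith [near1m y κ _ hy i]
    exact sinhDiv_eq_zero_of_EL (gaugeAct u₀ U) A y (fun κ => ⟨hUA y κ hy0, hUA _ κ (hym κ)⟩) (fun κ => ⟨hskew y κ hy0, hskew _ κ (hym κ)⟩) (hEL y hy0)
  have hP : ∀ (y : Site 4) (ν : Fin 4), (∀ i, |y i - z i| ≤ (((nbRad 4 L + 2 * ℓ + 12) * L ^ (k + 1) + 2 : ℕ) : ℤ) - 2) →
      ‖(∑ μ', (((2 : ℂ)⁻¹ • (exp (A (y + e ν) μ') - exp (-A (y + e ν) μ')))
                - ((2 : ℂ)⁻¹ • (exp (A (y + e ν - e μ') μ') - exp (-A (y + e ν - e μ') μ'))))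
          - ∑ μ', (((2 : ℂ)⁻¹ • (exp (A y μ') - exp (-A y μ'))) - ((2 : ℂ)⁻¹ • (exp (A (y - e μ') μ') - exp (-A (y - e μ') μ')))))‖
        ≤ 0 * (r + 4 * (Real.exp β - 1) + ε) / ((L : ℝ) ^ (k + 1)) ^ 3 := by
    intro y ν hy
    have h1 := hdivS y (fun i => (hy i).trans (by linarith))
    have h2 := hdivS (y + e ν) (fun i => by linarith [near1 y ν _ hy i])
    rw [h2, h1, sub_zero, norm_zero]; simp
  -- now the arithmetic of F302 with `c_r = 0`, after F303
  have hM2n : 2 ≤ L ^ (k + 1) :=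
    calc 2 ≤ L := hL
      _ = L ^ 1 := (pow_one L).symm
      _ ≤ L ^ (k + 1) := Nat.pow_le_pow_right (by omega) (by omega)
  have hMr' : (L : ℝ) ^ (k + 1) = ((L ^ (k + 1) : ℕ) : ℝ) := by rw [Nat.cast_pow]
  have hnb : nbRad 4 L = 10 * L := by unfold BlockAverageVaryHolo.nbRad; ring
  rw [hnb] at hUA hA0 hp hP
  rw [hMr'] at hUr hcur hA0 hP ⊢
  generalize hMdef : L ^ (k + 1) = Mn at *
  have hMr : (2 : ℝ) ≤ (Mn : ℝ) := by exact_mod_cast hM2n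
  have hM0 : (0 : ℝ) < (Mn : ℝ) := by linarith
  set t : ℝ := r + 4 * (Real.exp β - 1) + ε with htdef
  have hβ' : 0 ≤ 4 * (Real.exp β - 1) := by nlinarith [Real.add_one_le_exp β]
  have hrt : r ≤ t := by rw [htdef]; linarith
  have ht0 : 0 ≤ t := hr0.trans hrt
  have hℓ0 : (0 : ℝ) ≤ (ℓ : ℝ) := Nat.cast_nonneg ℓ
  have hL2r : (2 : ℝ) ≤ (L : ℝ) := by exact_mod_cast hL
  have hL' : (32 : ℝ) ≤ Lp := by rw [hLp]; linarith
  have hLp0 : 0 < Lp := by linarith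
  have ht' : t ≤ 1 / (1024 * (Lp) * (c₀ + 1)) :=
    ht.trans (div_le_div_of_nonneg_left (by norm_num) (by positivity) (by nlinarith))
  have ht1 : t ≤ 1 := ht'.trans (by rw [div_le_one (by positivity)]; nlinarith)
  -- the absorption condition (EL form)
  have hρ0 : 0 ≤ c₀ * t / (Mn : ℝ) := by positivity
  have hct : (c₀ + 1) * t ≤ 1 / (1152 * (Lp)) := by
    rw [le_div_iff₀ (by positivity)] at ht; rw [le_div_iff₀ (by positivity)]; nlinarith
  have h4ρ : 4 * (c₀ * t / (Mn : ℝ)) ≤ 1 := by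
    rw [show 4 * (c₀ * t / (Mn : ℝ)) = 4 * (c₀ * t) / Mn by ring, div_le_one hM0]
    have h2 : 1 / (1152 * (Lp)) ≤ 1 / 1152 := by
      apply div_le_div_of_nonneg_left (by norm_num) (by norm_num); nlinarith
    nlinarith
  have hρ1 : c₀ * t / (Mn : ℝ) ≤ 1 := by linarith
  have hexp4 : Real.exp (4 * (c₀ * t / (Mn : ℝ))) - 1 ≤ 8 * (c₀ * t / (Mn : ℝ)) := by
    have := exp_sub_one_le_two_mul (by positivity : 0 ≤ 4 * (c₀ * t / (Mn : ℝ))) h4ρ; linarith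
  have hexp1 : Real.exp (c₀ * t / (Mn : ℝ)) - 1 ≤ 2 * (c₀ * t / (Mn : ℝ)) := exp_sub_one_le_two_mul hρ0 hρ1
  have hLpne : Lp ≠ 0 := ne_of_gt hLp0
  have hR2 : (((10 * L + 2 * ℓ + 12) * Mn + 2 - 2 : ℕ) : ℝ) = (Lp) * Mn := by
    rw [Nat.add_sub_cancel, hLp]; push_cast; ring
  have hs : 32 * ((3 + 1 : ℕ) : ℝ) * (((10 * L + 2 * ℓ + 12) * Mn + 2 - 2 : ℕ) : ℝ) * (Real.exp (4 * (c₀ * t / (Mn : ℝ))) - 1)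
      + 16 * ((3 + 1 : ℕ) : ℝ) * (((10 * L + 2 * ℓ + 12) * Mn + 2 - 2 : ℕ) : ℝ) * (Real.exp (c₀ * t / (Mn : ℝ)) - 1) ≤ 1 := by
    rw [hR2, show ((3 + 1 : ℕ) : ℝ) = 4 by norm_num]
    have h1 : 32 * 4 * ((Lp) * Mn) * (Real.exp (4 * (c₀ * t / (Mn : ℝ))) - 1)
        ≤ 32 * 4 * ((Lp) * Mn) * (8 * (c₀ * t / (Mn : ℝ))) := mul_le_mul_of_nonneg_left hexp4 (by positivity)
    have h2 : 16 * 4 * ((Lp) * Mn) * (Real.exp (c₀ * t / (Mn : ℝ)) - 1)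
        ≤ 16 * 4 * ((Lp) * Mn) * (2 * (c₀ * t / (Mn : ℝ))) := mul_le_mul_of_nonneg_left hexp1 (by positivity)
    have e1 : 32 * 4 * ((Lp) * Mn) * (8 * (c₀ * t / (Mn : ℝ))) + 16 * 4 * ((Lp) * Mn) * (2 * (c₀ * t / (Mn : ℝ)))
        = 1152 * (Lp) * (c₀ * t) := by field_simp; ring
    have h3 : 1152 * (Lp) * (c₀ * t) ≤ 1 := by
      have h4 : c₀ * t ≤ (c₀ + 1) * t := by nlinarith
      have h5 := mul_le_mul_of_nonneg_left (h4.trans hct) (by positivity : (0 : ℝ) ≤ 1152 * (Lp))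
      have e2 : 1152 * (Lp) * (1 / (1152 * (Lp))) = 1 := by field_simp
      linarith
    linarith
  -- F303 at `R₀ = (2ℓ+32)M + 2`, depth `M`
  have hR3 : 3 ≤ (10 * L + 2 * ℓ + 12) * Mn + 2 := by nlinarith
  have hcast : (((10 * L + 2 * ℓ + 12) * Mn + 2 : ℕ) : ℤ) - 2 = (((10 * L + 2 * ℓ + 12) * Mn : ℕ) : ℤ) := by push_cast; ring
  have h := norm_fdiff_le_of_landauEL_cube (d := 3) (n := n) (ε := r / (Mn : ℝ) ^ 2) (by positivity) hUr hu₀ z ((10 * L + 2 * ℓ + 12) * Mn + 2) hR3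
    (ρ := c₀ * t / (Mn : ℝ)) (j := C * r / (Mn : ℝ) ^ 3) (r := 0 * t / (Mn : ℝ) ^ 3) hρ0 (by positivity) (by positivity) hUA hA0
    (fun y ν hy => hcur ν y) (fun y ν hy => hP y ν hy) hs p Mn (by omega)
    (fun i => by have := hp i; push_cast at this ⊢; nlinarith [this]) μ τ
  rw [hR2] at h
  refine h.trans ?_
  have key := gradLetter_arith (M := (Mn : ℝ)) (L' := Lp) (C := C) (c_r := 0) hMr hL' hr0 hrt ht1 hc₀ hC ht'
  refine le_trans (le_of_eq ?_) key
  ring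

end

end Summit.QuantumFields.BalabanUV.T4Continuum.NE7CubeChartOfLandauELGeneric
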